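import Summits.Ventures.PercRepro.S2NineCaps

/-!
# PercRepro — S2: THE CIRCUIT CAPS AT CORANK `13` — THE CELLS `(13, 13)`, `(12, 13)` AND `(11, 13)` (p7, gen 19; sub-claim S2; the row `p = 13`)

The caps the cells of corank `13` feed to the kit: on the coloop-free `e`-free core of rank `13` on `26` points `s₃ ≤ 34` (`TriangleCap.cq3 13`),
`s₄ ≤ 385 = ⌊26·326/22⌋` (the averaging recursion on `avgChain16 12 = 326`), `s₅ ≤ 3872 = ⌊26·3128/21⌋`
(on `avgChain5b 12 = 3128`) — **`caps_thirteen_thirteen_cf`**; on the scaled coloop-free cell `(12, 13)` (`25` points) `34 / 388 / 3910` —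
**`caps_twelve_thirteen_cf`**; on the twice-scaled cell `(11, 13)` (`24` points, coloops allowed) the plain nullity-`13` caps `34 / 419 / 4331`
(`avgChain16 13`, `avgChain5b 13`) — **`caps_eleven_thirteen`**. Nothing about any cell is claimed. Axioms: standard.
-/

open scoped Matroid

namespace PercRepro

namespace ThmN

open Set

variable {α : Type}

/-- The coloop-free caps at `(13, 13)`: `s₃ ≤ 34`, `s₄ ≤ 385` (`⌊26·326/22⌋` on `avgChain16 12`), `s₅ ≤ 3872` (`⌊26·3128/21⌋`). -/
theorem caps_thirteen_thirteen_cf (M : Matroid α) [M.Finite]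
    (hd : M.E.encard = M.eRank + ((13 : ℕ) : ℕ∞)) (hn : M.E.ncard = 13 + 13)
    (hfree : ∀ e ∈ M.E, ∃ A ⊆ M.E \ {e}, e ∉ M.closure A ∧ e ∉ M.closure ((M.E \ {e}) \ A)) (hK : ∀ e, ¬ M.IsColoop e) :
    {C : Set α | M.IsCircuit C ∧ C.ncard = 3}.ncard ≤ 34 ∧
      {C : Set α | M.IsCircuit C ∧ C.ncard = 4}.ncard ≤ 385 ∧
        {C : Set α | M.IsCircuit C ∧ C.ncard = 5}.ncard ≤ 3872 := by
  have hs3 := TriangleCap.core_ncard_triangles_le_cq3 M hfree hd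
  rw [show TriangleCap.cq3 13 = 34 by decide] at hs3
  have hcol : M.coloops = ∅ := S2.coloops_eq_empty_of_forall_not M hK
  have hm : 26 ≤ (M.E \ M.coloops).ncard := by
    rw [hcol, Set.sdiff_empty, hn]
  have hd' : M.E.encard = M.eRank + (((12 : ℕ) : ℕ∞) + 1) := by
    rw [hd]; norm_num
  have h := S1.ncard_fourCircuits_sub_div_le_of_nonColoops M hfree hd' (by norm_num) hm (B := 326)
    (fun M' _ hfree' hd'' => by
      have h := ncard_fourCircuits_le_avgChain16 12 M' hfree' hd''
      rw [show avgChain16 12 = 326 by decide] at h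
      exact h)
  have hs4 : {C : Set α | M.IsCircuit C ∧ C.ncard = 4}.ncard ≤ 385 := by
    have := S1.le_mul_div_of_sub_div_le (by norm_num : 4 < 26) h
    omega
  have hs5 := S2.ncard_fiveCircuits_le_of_no_coloop M hfree hd' hK (by omega)
  rw [hn] at hs5
  have h5 : (13 + 13) * S1.avgChain5b 12 / (13 + 13 - 5) = 3872 := by
    rw [show S1.avgChain5b 12 = 3128 by decide]
  rw [h5] at hs5
  exact ⟨hs3, hs4, hs5⟩

/-- The coloop-free caps at `(12, 13)`: `s₃ ≤ 34`, `s₄ ≤ 388` (`⌊25·326/21⌋` on `avgChain16 12`), `s₅ ≤ 3910` (`⌊25·3128/20⌋`). -/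
theorem caps_twelve_thirteen_cf (M : Matroid α) [M.Finite]
    (hd : M.E.encard = M.eRank + ((13 : ℕ) : ℕ∞)) (hn : M.E.ncard = 12 + 13)
    (hfree : ∀ e ∈ M.E, ∃ A ⊆ M.E \ {e}, e ∉ M.closure A ∧ e ∉ M.closure ((M.E \ {e}) \ A)) (hK : ∀ e, ¬ M.IsColoop e) :
    {C : Set α | M.IsCircuit C ∧ C.ncard = 3}.ncard ≤ 34 ∧
      {C : Set α | M.IsCircuit C ∧ C.ncard = 4}.ncard ≤ 388 ∧
        {C : Set α | M.IsCircuit C ∧ C.ncard = 5}.ncard ≤ 3910 := by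
  have hs3 := TriangleCap.core_ncard_triangles_le_cq3 M hfree hd
  rw [show TriangleCap.cq3 13 = 34 by decide] at hs3
  have hcol : M.coloops = ∅ := S2.coloops_eq_empty_of_forall_not M hK
  have hm : 25 ≤ (M.E \ M.coloops).ncard := by
    rw [hcol, Set.sdiff_empty, hn]
  have hd' : M.E.encard = M.eRank + (((12 : ℕ) : ℕ∞) + 1) := by
    rw [hd]; norm_num
  have h := S1.ncard_fourCircuits_sub_div_le_of_nonColoops M hfree hd' (by norm_num) hm (B := 326)
    (fun M' _ hfree' hd'' => by
      have h := ncard_fourCircuits_le_avgChain16 12 M' hfree' hd''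
      rw [show avgChain16 12 = 326 by decide] at h
      exact h)
  have hs4 : {C : Set α | M.IsCircuit C ∧ C.ncard = 4}.ncard ≤ 388 := by
    have := S1.le_mul_div_of_sub_div_le (by norm_num : 4 < 25) h
    omega
  have hs5 := S2.ncard_fiveCircuits_le_of_no_coloop M hfree hd' hK (by omega)
  rw [hn] at hs5
  have h5 : (12 + 13) * S1.avgChain5b 12 / (12 + 13 - 5) = 3910 := by
    rw [show S1.avgChain5b 12 = 3128 by decide]
  rw [h5] at hs5
  exact ⟨hs3, hs4, hs5⟩

/-- The caps at `(11, 13)` (coloops allowed): `s₃ ≤ 34`, `s₄ ≤ 419 = avgChain16 13`, `s₅ ≤ 4331 = avgChain5b 13`. -/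
theorem caps_eleven_thirteen (M : Matroid α) [M.Finite]
    (hd : M.E.encard = M.eRank + ((13 : ℕ) : ℕ∞))
    (hfree : ∀ e ∈ M.E, ∃ A ⊆ M.E \ {e}, e ∉ M.closure A ∧ e ∉ M.closure ((M.E \ {e}) \ A)) :
    {C : Set α | M.IsCircuit C ∧ C.ncard = 3}.ncard ≤ 34 ∧
      {C : Set α | M.IsCircuit C ∧ C.ncard = 4}.ncard ≤ 419 ∧
        {C : Set α | M.IsCircuit C ∧ C.ncard = 5}.ncard ≤ 4331 := by
  have hs3 := TriangleCap.core_ncard_triangles_le_cq3 M hfree hd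
  rw [show TriangleCap.cq3 13 = 34 by decide] at hs3
  have hs4 := ncard_fourCircuits_le_avgChain16 13 M hfree hd
  rw [show avgChain16 13 = 419 by decide] at hs4
  have hs5 := S1.ncard_fiveCircuits_le_avgChain5b 13 M hfree hd
  rw [show S1.avgChain5b 13 = 4331 by decide] at hs5
  exact ⟨hs3, hs4, hs5⟩

end ThmN

end PercRepro
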